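import Mathlib
import HarnessLib
import HarnessLib.Audit
import Summits.HodgeConjecture.HodgeConjecture.Theses.LimitExtension
import Summits.HodgeConjecture.HodgeConjecture.Theses.FiniteTreeOfFlavours
import Summits.HodgeConjecture.HodgeConjecture.Theses.MotivatedLefschetzSplit
import Summits.HodgeConjecture.HodgeConjecture.Theses.GaloisSieve
import Literature.AlgebraicGeometry.HodgeTheory.MotivatedClassesProofs
import Literature.AlgebraicGeometry.HodgeTheory.HypersurfaceLefschetz

/-!
# Line `andre-motivated-hypersurfaces` — ALTERNATIVE skeleton for the crux `HypersurfaceHodge` (stmt-HodgeConjecture-1491)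

Strategist line (crux-strategist seat `cstrat-stmt-HodgeConjecture-1491-s2`, 2026-08-17), PUBLISHED ALONGSIDE the
live line `birth` (movable / rigid dichotomy) and never replacing it: it is deliberately NOT run through
`ledger skeleton check` (which would re-register the item's skeleton over birth); a lead who picks it registers it
(prover L1). Local `#h21_check_skeleton` audit: ok (codes [], `HypersurfaceHodge_of` concludes the crux by name).

THE LINE = André's chain `Hodge ⊆ Motivated ⊆ Algebraic`, restricted to smooth hypersurfaces.
Lens: TRANSFER from the solved sibling "abelian varieties" — Deligne 1982 (Hodge ⇒ absolute Hodge) /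
André 1996 Thm 0.6.2 (Hodge ⇒ MOTIVATED on abelian varieties). The two engines of that proof port to the
universal hypersurface family `U_{n,d}` as follows: Principle B (deformation along a connected base) ports
VERBATIM — André's deformation theorem 0.5 (tree named fact
`Literature.AlgebraicGeometry.HodgeTheory.Andre1996_deformation`) is unconditional for ANY smooth projective
family, so motivatedness of a Hodge class propagates along every connected component of its Hodge locus in
`U_{n,d}`; the step that does NOT port is the density of CM points in special subvarieties of Shimura
varieties (in level ≥ 3 the whole Hodge locus of `U_{n,d}` is conjecturally a FINITE union of special
subvarieties, Baldi–Klingler–Ullmo 2024 Conj. 2.5, and CM hypersurfaces are sparse) — that residue is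
exactly `stub_hypersurfaceMiddleHodgeClassesMotivated` below, restricted in content to ONE anchor point per
Hodge-locus component plus the rigid points. The price of the transfer is conjecture B (Grothendieck's
standard conjecture of Lefschetz type), cited BY NAME as the existing crux of route MotivatedLefschetzSplit.

What this line buys relative to `birth`: (i) NO field-of-definition stub (`RigidImpliesQbar`,
stmt-HodgeConjecture-1494, disappears: motivatedness along a component is blind to `ℚ̄`); (ii) at CM / Fermat
points the required statement is KNOWN (Hodge classes on Fermat hypersurfaces are motivated: Shioda–Katsura
inductive structure + André 0.6.2), whereas `birth`'s `RigidQbarClassesAlgebraic` contains HC for Fermat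
degree ≥ 21, open; (iii) along positive-dimensional Hodge loci only ONE motivated (e.g. algebraic) member per
component is needed (André 0.5), not a cycle at the generic member. What it costs: `LefschetzStandardB` for
ALL smooth projective varieties (open; implied by HC; shared with route MotivatedLefschetzSplit, item
stmt-HodgeConjecture-17489) and the formalisation support `DiagonalPullbackAlgebraic` (stmt-HodgeConjecture-17490).

Declared stubs (4; two open problems, two theorems-in-print):
* `stub_hypersurfaceMiddleHodgeClassesMotivated` (NEW; the load-bearing stub) — every rational `(k,k)`-class in
  the MIDDLE degree `H²ᵏ` of a smooth hypersurface of EVEN dimension `2k` is MOTIVATED (André Déf. 1, tree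
  carrier `motivatedClasses`). A weakening of MotivatedLefschetzSplit.HodgeClassesMotivated
  (stmt-HodgeConjecture-17488: all smooth projective `X`, deep middle) to the one big-monodromy family.
* `stub_lefschetzStandardB : MotivatedLefschetzSplit.LefschetzStandardB` (stmt-HodgeConjecture-17489, BY NAME).
* `stub_diagonalPullbackAlgebraic : MotivatedLefschetzSplit.DiagonalPullbackAlgebraic`
  (stmt-HodgeConjecture-17490, BY NAME; Voisin II Prop. 9.21 (i), difficulty L).
* `stub_hypersurfaceLefschetz : GaloisSieve.HypersurfaceLefschetz` (stmt-HodgeConjecture-11281, BY NAME; Lefschetz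
  off the middle degree for smooth hypersurfaces, Voisin II Cor. 1.24–1.25; verbatim the tree named fact
  `Voisin2003_smoothHypersurface_algebraicClasses_eq_top`).
* `hypersurfaceHodge_from` — the GLUE in hypotheses form (REAL proof, no sorry, axioms {propext, Classical.choice,
  Quot.sound}): Hodge-model conjunct from the route's proved support `HodgeModels_holds`; cycle conjunct by the
  case split `2p = n` (middle: stub 1 gives motivated, André's §2.1 remark — tree theorem
  `motivatedClasses_le_algebraicClasses_of_standardConjectureB_of_map_diagonal` — turns B + Δ into `A_mot ⊆ A`)
  / `2p ≠ n` (off-middle: `algebraicClasses X p = ⊤` by stub 4 through the tree assembly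
  `Voisin2003_smoothHypersurface_algebraicClasses_eq_top.of_two_mul_ne`); its conclusion is the crux unfolded one
  step (so that it is not itself taken for the skeleton theorem).
* `HypersurfaceHodge_of : LimitExtension.HypersurfaceHodge` — THE skeleton theorem: the crux BY NAME from the four
  declared stubs through the glue (`sorry` only transitively, inside the stubs).
* `FiniteTreeOfFlavours_HypersurfaceHodge_of` — the same under the item's OTHER route name (its first `wanted_by`
  decl), so the audit is clean whichever decl the checker resolves.

Disproof used: none exists for this crux (`ledger crux ls stmt-HodgeConjecture-1491`: only Lines/birth.*; no
Disproof.lean, no `_false_without_` theorem, no landed Negative lemma). Negatives index (3 entries 2026-08-17: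
MilnorK symbol lift 17744, Fermat–K3 multisets 11121, E-line matrices 12555): no stub is an instance.
-/

set_option linter.dupNamespace false
set_option linter.unusedVariables false

namespace Summit.HodgeConjecture.HodgeConjecture.Cruxes.HypersurfaceHodge.AndreMotivatedHypersurfaces

open Literature.AlgebraicGeometry.Motives (SchemeOver IsSmoothHypersurface IsSmoothProjective)
open Literature.AlgebraicGeometry.HodgeTheory
open Summit.HodgeConjecture.HodgeConjecture.Theses.LimitExtension (HodgeModels_holds)

/-! ## The four registered stubs -/

/-- **Stub 1 (NEW, load-bearing) — middle-degree Hodge classes on even-dimensional smooth hypersurfaces are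
MOTIVATED.** For every smooth hypersurface `X ⊂ ℙ^{2k+1}_ℂ` of dimension `2k` and degree `d` and every rational class
`c ∈ H²ᵏ(X(ℂ); ℂ)` of Hodge type `(k,k)`, `c ∈ A_motᵏ(X)_ℂ` (`motivatedClasses (2k) X k`, André 1996 Déf. 1 on the
real carriers). Why plausibly true: implied by HC (algebraic ⊆ motivated, tree `algebraicClasses_le_motivatedClasses`);
KNOWN at every CM / Fermat member (Shioda–Katsura inductive structure: the Fermat motive is cut out on a product of
Fermat-curve Jacobians; André Thm 0.6.2), for cubic fourfolds (André Thm 0.6.3: motive cut out on an abelian variety),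
for `d ≤ 2`, and for `k ≤ 1` (tree `mem_motivatedClasses_of_lefschetzRange`: Lefschetz (1,1) + hard Lefschetz);
PROPAGATES along every connected component of a Hodge locus in `U_{2k,d}` from one motivated member (André's
deformation theorem 0.5 = tree fact `Andre1996_deformation`, unconditional). Why it might fail: a rigid
(zero-period-dimensional) Hodge class on a non-CM hypersurface of level ≥ 3 that is not motivated — equivalently not
absolute Hodge in André's sense — would kill it (and Deligne's 'Hodge ⇒ absolute Hodge' expectation) without formally
refuting HC; first open instances: 0-dimensional components of Noether–Lefschetz / Hodge loci of sextic fourfolds in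
`ℙ⁵`. A WEAKENING of MotivatedLefschetzSplit's crux `HodgeClassesMotivated` (stmt-HodgeConjecture-17488: all smooth
projective `X`, deep middle `2 ≤ p ≤ n/2`) to the one big-monodromy family. Size: open problem (XL), strictly weaker
than the crux. (Stated inline, not as a `def`: crux workfiles may not carry `@[stub]` tags, and the skeleton audit
admits only named obligations as hypotheses — so the composition below CONSUMES this stub instead of assuming it.) -/
theorem stub_hypersurfaceMiddleHodgeClassesMotivated :
    ∀ ⦃k d : ℕ⦄ ⦃X : Literature.AlgebraicGeometry.Motives.SchemeOver ℂ⦄,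
      Literature.AlgebraicGeometry.Motives.IsSmoothHypersurface (2 * k) d X →
      ∀ c : Literature.AlgebraicGeometry.HodgeTheory.complexBetti X (2 * k),
        Literature.AlgebraicGeometry.HodgeTheory.IsRationalClass c →
        Literature.AlgebraicGeometry.HodgeTheory.IsOfHodgeType (2 * k) X (2 * k) k k c →
          c ∈ Literature.AlgebraicGeometry.HodgeTheory.motivatedClasses (2 * k) X k := by
  sorry

/-- **Stub 2 — Grothendieck's standard conjecture of Lefschetz type, André's form `⋆_L` algebraic** (= item
stmt-HodgeConjecture-17489, `MotivatedLefschetzSplit.LefschetzStandardB`, verbatim BY NAME; a proof of this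
stub is literally a proof of that crux). Known for curves, surfaces, abelian varieties (Lieberman 1968),
complete intersections, flag varieties, several hyperkähler types; implied by HC(Z × Z) (Kleiman 1968).
Why it might fail: a threefold of general type with `h^{2,0} ≠ 0` whose inverse Lefschetz map is not
algebraic. Size: open problem (XL). -/
theorem stub_lefschetzStandardB :
    Summit.HodgeConjecture.HodgeConjecture.Theses.MotivatedLefschetzSplit.LefschetzStandardB := by
  sorry

/-- **Stub 3 — diagonal pull-back preserves the coniveau** (= item stmt-HodgeConjecture-17490,
`MotivatedLefschetzSplit.DiagonalPullbackAlgebraic`, verbatim BY NAME): for `V` smooth projective and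
`c ∈ Nᵖ H²ᵖ((V × V)(ℂ); ℂ)`, `Δ^* c ∈ Nᵖ H²ᵖ(V(ℂ); ℂ)` (Voisin II Prop. 9.21 (i) + Chow's moving lemma +
Fulton §19.1 purity). The one input the tree isolates for André's remark "B ⇒ A_mot ⊆ A". Theorem in print;
size L as Lean. -/
theorem stub_diagonalPullbackAlgebraic :
    Summit.HodgeConjecture.HodgeConjecture.Theses.MotivatedLefschetzSplit.DiagonalPullbackAlgebraic := by
  sorry

/-- **Stub 4 — Lefschetz off the middle degree for smooth hypersurfaces** (= item stmt-HodgeConjecture-11281,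
`GaloisSieve.HypersurfaceLefschetz`, verbatim BY NAME; `Iff.rfl` with the tree named fact
`Voisin2003_smoothHypersurface_algebraicClasses_eq_top`): for `0 < p < n`, `2p ≠ n`, every class of
`H²ᵖ(Y(ℂ); ℂ)` on a smooth hypersurface `Y ⊂ ℙⁿ⁺¹` is algebraic (`H²ᵖ = ℂ·hᵖ`, Voisin II Cor. 1.24–1.25;
the tree reduces it to the surjectivity of `ι^*`, `algebraicClasses_eq_top_of_surjective_map`). Theorem in
print; size M–L as Lean. -/
theorem stub_hypersurfaceLefschetz :
    Summit.HodgeConjecture.HodgeConjecture.Theses.GaloisSieve.HypersurfaceLefschetz := by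
  sorry

/-! ## The composition: the four stubs prove the crux BY NAME -/

/-- **The glue, hypotheses form** (`stub₁-sig → stub₂-sig → stub₃-sig → stub₄-sig → ∀ n d X, IsSmoothHypersurface n d X →
HodgeConjectureFor n X`; REAL proof, no sorry, axioms {propext, Classical.choice, Quot.sound}; the conclusion is the
crux UNFOLDED one step on purpose, so that the skeleton audit takes `HypersurfaceHodge_of` below — which concludes the
crux BY NAME — as the skeleton theorem). For a smooth `(n,d)`-hypersurface `X` (`hX.1 : IsSmoothProjective n X`) the
Hodge-model conjunct of `HodgeConjectureFor n X` is the route's proved support `HodgeModels` (`HodgeModels_holds`); for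
a rational `(p,p)`-class `c`: if `2p = n`, stub 1 makes `c` motivated and André's §2.1 remark (tree theorem
`motivatedClasses_le_algebraicClasses_of_standardConjectureB_of_map_diagonal`, fed with stubs 3 and 2) makes it
algebraic; if `2p ≠ n`, stub 4 via `Voisin2003_….of_two_mul_ne` gives `algebraicClasses X p = ⊤`. [folklore] -/
theorem hypersurfaceHodge_from
    (hMot : ∀ ⦃k d : ℕ⦄ ⦃X : Literature.AlgebraicGeometry.Motives.SchemeOver ℂ⦄,
      Literature.AlgebraicGeometry.Motives.IsSmoothHypersurface (2 * k) d X →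
      ∀ c : Literature.AlgebraicGeometry.HodgeTheory.complexBetti X (2 * k),
        Literature.AlgebraicGeometry.HodgeTheory.IsRationalClass c →
        Literature.AlgebraicGeometry.HodgeTheory.IsOfHodgeType (2 * k) X (2 * k) k k c →
          c ∈ Literature.AlgebraicGeometry.HodgeTheory.motivatedClasses (2 * k) X k)
    (hB : Summit.HodgeConjecture.HodgeConjecture.Theses.MotivatedLefschetzSplit.LefschetzStandardB)
    (hΔ : Summit.HodgeConjecture.HodgeConjecture.Theses.MotivatedLefschetzSplit.DiagonalPullbackAlgebraic)
    (hLef : Summit.HodgeConjecture.HodgeConjecture.Theses.GaloisSieve.HypersurfaceLefschetz) :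
    ∀ ⦃n d : ℕ⦄ ⦃X : Literature.AlgebraicGeometry.Motives.SchemeOver ℂ⦄,
      Literature.AlgebraicGeometry.Motives.IsSmoothHypersurface n d X →
        Literature.AlgebraicGeometry.HodgeTheory.HodgeConjectureFor n X := by
  intro n d X hX
  refine ⟨HodgeModels_holds hX.1, fun p c hc hpp => ?_⟩
  by_cases h : 2 * p = n
  · subst h
    exact motivatedClasses_le_algebraicClasses_of_standardConjectureB_of_map_diagonal hΔ hB hX.1 p
      (hMot hX c hc hpp)
  · have htop : algebraicClasses X p = ⊤ :=
      Voisin2003_smoothHypersurface_algebraicClasses_eq_top.of_two_mul_ne hLef hX p h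
    rw [htop]
    exact Submodule.mem_top

/-- **THE SKELETON THEOREM**: the crux `Summit.HodgeConjecture.HodgeConjecture.Theses.LimitExtension.HypersurfaceHodge`
BY NAME, from the four DECLARED stubs (its only `sorry`s, transitively) through `hypersurfaceHodge_from`. [folklore] -/
theorem HypersurfaceHodge_of :
    Summit.HodgeConjecture.HodgeConjecture.Theses.LimitExtension.HypersurfaceHodge :=
  hypersurfaceHodge_from stub_hypersurfaceMiddleHodgeClassesMotivated stub_lefschetzStandardB
    stub_diagonalPullbackAlgebraic stub_hypersurfaceLefschetz

/-- **The same skeleton under the crux's other name** (the item stmt-HodgeConjecture-1491 is shared; its first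
`wanted_by` decl is `FiniteTreeOfFlavours.HypersurfaceHodge`, definitionally the same proposition). [folklore] -/
theorem FiniteTreeOfFlavours_HypersurfaceHodge_of :
    Summit.HodgeConjecture.HodgeConjecture.Theses.FiniteTreeOfFlavours.HypersurfaceHodge :=
  hypersurfaceHodge_from stub_hypersurfaceMiddleHodgeClassesMotivated stub_lefschetzStandardB
    stub_diagonalPullbackAlgebraic stub_hypersurfaceLefschetz

/-! ## Converse record (informational): the crux implies stub 1 in print (algebraic ⊆ motivated needs a
hard-Lefschetz witness on `X ⊗ X`, tree `algebraicClasses_le_motivatedClasses_of_nonempty_hardLefschetzNFold`);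
`HodgeConjecture → crux` is `fun h _ _ _ hX => h hX.1` (recorded in Lines/birth.lean). -/

end Summit.HodgeConjecture.HodgeConjecture.Cruxes.HypersurfaceHodge.AndreMotivatedHypersurfaces
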